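/-
Copyright: literature formalisation for the harness. Statements follow the cited text.
-/
import Literature.AlgebraicGeometry.CossartPiltant200819.Ramification2008
import Mathlib.Data.Nat.Fib.Basic
import Mathlib.NumberTheory.Real.GoldenRatio
import Mathlib.Data.Matrix.Mul
import Mathlib.Data.Real.Basic
import Mathlib.Data.ZMod.Defs
import Mathlib.Tactic.IntervalCases
import Mathlib.Tactic.FinCases
import HarnessLib

/-!
# Cossart–Piltant I (2008), Lemma 9.4 (= journal Lemma 9.2) — anatomy of the printed tame descent

V. Cossart, O. Piltant, *Resolution of singularities of threefolds in positive characteristic I*,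
J. Algebra 320 (2008) 1051–1082 [CossartPiltant2008]; authors' manuscript hal-00139124 ("HAL"),
whose Lemma 9.4 (HAL p. 29; journal Lemma 9.2) is the TAME CYCLIC DESCENT of local
uniformization: `L/K` Galois of prime degree `l ≠ p`, transcendence degree three over `k`, `W` of
rank one with `κ(W)/k` algebraic, `V := W ∩ K`; LU(`W`) ⇒ LU(`V`). The statement itself is the
named fact `CP2008.TamePrimeDescent` (`Ramification2008`). This file records, at statement level
and in the same idiom, the STRUCTURE OF ITS PRINTED PROOF (HAL p. 30, l. 3–65), for the purpose of
a line-by-line reading; it asserts nothing beyond what is proved below.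

* `GStableUniformizationAbove` — the statement (S3\*) which the printed proof USES at HAL p. 30,
  l. 14–16: "Let `R₀` be a normal local model of `V/k` satisfying the conclusion of proposition
  6.2, and let `S` be a local uniformization of `W/k` such that `R̃₀ < S`. … Also `S` is stable by
  `G`, since any conjugate of `S` is dominated by `W`, hence equal to `S`." Typed here as a
  predicate of `(W, R₀)`: there is a local uniformization `S` of `W` containing `R̃₀`
  (`normalModelAbove W R₀`) with `σ(S) = S` for all `σ ∈ Gal(L/K)`; the printed proof needs it for
  the normal local models `R₀` of `V` given by Prop. 6.2. This is NOT a theorem of the paper and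
  is not claimed here (it occurs only as a hypothesis of `tamePrimeDescent_of_viaStableModel`): the printed justification ("any conjugate of `S` is dominated by
  `W`, hence equal to `S`") does not hold in general — two distinct regular local rings essentially
  of finite type with the same fraction field can be dominated by the same valuation ring (e.g.
  `S₀ = k[x₁,x₂,x₃]_{(x)}` with the diagonal `ℤ/5`-action `xᵢ ↦ ζ^{tᵢ}xᵢ`, `t = (1,2,0)`, `W`
  monomial with `ℚ`-independent weights, and `S = S₀[(x₁+x₂)/x₃]` localised at the centre of `W`:
  `S` and `gS ≠ S` are both dominated by `W`). What the sequel (l. 16–65) needs is exactly the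
  typed statement.
* `TamePrimeDescentViaStableModel` — the implication which HAL p. 30, l. 16–65 establishes (given
  the lattice step below): in the situation of Lemma 9.4, IF for every normal local model `R₀` of
  `V` a `G`-stable local uniformization of `W` above `R̃₀` exists, THEN `V` has a local
  uniformization.
* `tamePrimeDescent_of_viaStableModel` — PROVED bookkeeping:
  `TamePrimeDescentViaStableModel → (∀ data of Lemma 9.4, LU(W) → ∀ R₀ normal local model of V,
  GStableUniformizationAbove W R₀) → TamePrimeDescent`, i.e. the printed argument proves
  Lemma 9.4 from (S3\*), and from nothing less that this file names.
* `LatticeABC d l t w` — the lattice step of HAL p. 30, l. 23–31 in `d` variables ("there exists a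
  basis `(v₁,v₂,v₃)` of `ℤ³` having the following properties (a) `(lv₁,v₂,v₃)` is a basis of
  `N := {v : Σ vⱼtⱼ ≡ 0 mod l}`, (b) `ℕ³ ⊆ ℕv₁+ℕv₂+ℕv₃`, and (c) `Σⱼ vᵢⱼ W xⱼ ≥ 0`"), in the
  equivalent matrix form: a unimodular integer matrix `V` (rows `vᵢ`) with NONNEGATIVE inverse
  `C` ((b)), `V w ≥ 0` ((c)), and all rows but one killing `t` modulo `l`, the remaining row not
  ((a), using `[ℤᵈ : N] = l`). `latticeABC_dim_one` — PROVED for `d = 1`; `latticeABC_three_five_golden` — PROVED: the same golden data with a third coordinate (`w = (φ,1,1)`, `t = (1,2,2)`) DO satisfy (a)(b)(c), explicit witness; `not_latticeABC_two_five` — PROVED: the two-variable statement is FALSE (`l = 5`, `t = (1,2)`, `w = (φ,1)`; `column_domination` + `euclidChain_invariant`: the admissible nonnegative unimodular `C` form the Euclid chain of `(φ, 1)` and no row character vanishes); `latticeABC_of_good` — PROVED, any `d`: the finishing criterion of the reading notes (an admissible unimodular pair `(V, C)` in which one row's character generates the others' with small enough multipliers yields (a)(b)(c) by the row operations `vᵢ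 ← vᵢ − Pᵢ v_k`, matrix `finishN`). For `d = 2` the
  statement FAILS (e.g. `l = 5`, `t = (1,2)`, `w = (φ,1)`, `φ` the golden ratio: the nonnegative
  unimodular cones containing `(φ,1)` are the Fibonacci cones `⟨(F_{n+1},F_n),(F_n,F_{n-1})⟩`, and
  a column `(F_{n+1},F_n)` is proportional to `(1,2)` modulo `5` iff `5 ∣ 2F_{n+1} − F_n = L_n`,
  which never happens); the arithmetic core of that example is PROVED here as
  `fib_pair_mod_five : (2·F(n+1) + 4·F(n)) % 5 ≠ 0` (via the Pisano period,
  `fib_add_twenty_mod_five`). For `d ≥ 3` the statement holds (a proof by continued fractions,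
  using the third coordinate, is written out in the reading notes accompanying this file; it is
  not formalised here), so the printed "by elementary linear algebra" is repaired in the dimension
  where it is used, by an argument that uses `d ≥ 3`.

Tree cross-references (nothing duplicated): the invariant computation `κ[[z₁,z₂,z₃]]^G =
κ[[z₁ˡ,z₂,z₃]]` of HAL p. 30, l. 60–64 is `Resolution.TameCyclicInvariants`
(`isRegularLocalRing_of_fixed_pseudoReflection`, proved); the tame ASCENT and the frame in which
the tame descent enters Cossart–Piltant 2019 Prop. 4.10 is
`Resolution.ArithmeticalThreefoldsLocalTameAscent` (`tameAscent_of_descent`, which takes the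
descent as a hypothesis); Perron transforms are `Resolution.PerronTransforms`.

## Sources

* V. Cossart, O. Piltant, J. Algebra 320 (2008), Lemma 9.2 = HAL hal-00139124 Lemma 9.4
  (statement HAL p. 29, l. 90–95; proof HAL p. 30, l. 3–65), Prop. 6.2 (HAL p. 17–19, (29)).
  [CossartPiltant2008]
* V. Cossart, O. Piltant, J. Algebra 529 (2019) = arXiv:1412.0868, proof of Prop. 4.10:
  "Proving that (LU vⁱ), then (LU v) hold is an easy adaptation of [CoP1] proposition 9.3".
  [CossartPiltant2019]
-/

noncomputable section

namespace Literature.AlgebraicGeometry.CossartPiltant200819.CP2008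

open Literature.AlgebraicGeometry.Resolution

universe u

section Stable

variable {k K : Type u} [Field k] [Field K] [Algebra k K] {L : Type u} [Field L] [Algebra K L]
  [Algebra k L] in
/-- **(S3\*) at `R₀` — the statement used at HAL p. 30, l. 14–16 of the proof of Cossart–Piltant
2008, Lemma 9.4** (journal Lemma 9.2), VERBATIM locus: "Let `R₀` be a normal local model of `V/k`
satisfying the conclusion of proposition 6.2, and let `S` be a local uniformization of `W/k` such
that `R̃₀ < S`. We have `k(ζₗ) ⊂ S`. Also `S` is stable by `G`, since any conjugate of `S` is
dominated by `W`, hence equal to `S`." Typed as a predicate of the data (`W` a valuation ring of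
`L ⊇ K ⊇ k`, `R₀ ⊆ K`): there is a local uniformization `S ⊆ L` of `W` with `R̃₀ ⊆ S`
(`normalModelAbove W R₀ ⊆ S`) and `σ(S) = S` for every `σ : L ≃ₐ[K] L`. NOT a published theorem
and not asserted anywhere in this file: it is the implicit claim of the printed proof, whose
printed justification is insufficient (module docstring); it enters below only as a HYPOTHESIS.
[cite: CossartPiltant2008, Lemma 9.4, proof (HAL p. 30, l. 14–16)] -/
def GStableUniformizationAbove (W : ValuationSubring L) (R₀ : Subalgebra k K) : Prop :=
  ∃ S : Subalgebra k L, IsLocalUniformizationOf k L W S ∧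
    normalModelAbove W R₀ ⊆ (S : Set L) ∧ ∀ σ : L ≃ₐ[K] L, σ '' (S : Set L) = (S : Set L)

/-- **What HAL p. 30, l. 16–65 of the proof of Cossart–Piltant 2008, Lemma 9.4 establishes**
(journal Lemma 9.2; the steps `R := S^G`, Prop. 6.2 diagonalisation `g.xᵢ = ζ^{tᵢ}xᵢ`, the
lattice basis (a)(b)(c), `yᵢ := ∏ xⱼ^{vᵢⱼ}` (53)–(54), `R₁ := S₁^G`,
`Ŝ₁^G = κ(S₁)[[z₁ˡ, z₂, z₃]]` regular): in the situation of Lemma 9.4, if for every normal local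
model `R₀` of `V` there is a `Gal(L/K)`-stable local uniformization of `W` above `R̃₀`, then `V`
has a local uniformization. (The lattice step (a)(b)(c) at l. 23–31 holds in three variables —
see `LatticeABC` — so this implication is what the printed text proves.)
[cite: CossartPiltant2008, Lemma 9.4, proof (HAL p. 30, l. 16–65)] -/
def TamePrimeDescentViaStableModel : Prop :=
  ∀ (k K : Type u) [Field k] [Field K] [Algebra k K], (⊤ : IntermediateField k K).FG →
    Algebra.trdeg k K = 3 →
    ∀ (L : Type u) [Field L] [Algebra K L] [Algebra k L] [IsScalarTower k K L],
      FiniteDimensional K L → IsGalois K L →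
      (Module.finrank K L).Prime → ((Module.finrank K L : ℕ) : K) ≠ 0 →
      ∀ (W : ValuationSubring L) (hk : ∀ c : k, algebraMap k L c ∈ W),
        Nonempty W.valuation.RankOne → residueTrdeg k W hk = 0 →
          (∀ R₀ : Subalgebra k K, IsNormalLocalModelOf k K (W.comap (algebraMap K L)) R₀ →
            GStableUniformizationAbove (K := K) W R₀) →
          IsLocallyUniformizable k K (W.comap (algebraMap K L))

/-- **Bookkeeping of the printed proof of Lemma 9.4** (PROVED): the printed argument
(`TamePrimeDescentViaStableModel`) together with the implicitly used (S3\*) — in the situation of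
Lemma 9.4 with `W` locally uniformizable, `GStableUniformizationAbove W R₀` for every normal local
model `R₀` of `V` — gives the lemma (`TamePrimeDescent`). The second hypothesis is exactly what the
printed text consumes at HAL p. 30, l. 14–16 and does not prove.
[cite: CossartPiltant2008, Lemma 9.4 (HAL p. 29–30)] -/
theorem tamePrimeDescent_of_viaStableModel (h₁ : TamePrimeDescentViaStableModel.{u})
    (h₂ : ∀ (k K : Type u) [Field k] [Field K] [Algebra k K], (⊤ : IntermediateField k K).FG →
      Algebra.trdeg k K = 3 →
      ∀ (L : Type u) [Field L] [Algebra K L] [Algebra k L] [IsScalarTower k K L],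
        FiniteDimensional K L → IsGalois K L →
        (Module.finrank K L).Prime → ((Module.finrank K L : ℕ) : K) ≠ 0 →
        ∀ (W : ValuationSubring L) (hk : ∀ c : k, algebraMap k L c ∈ W),
          Nonempty W.valuation.RankOne → residueTrdeg k W hk = 0 →
            IsLocallyUniformizable k L W →
            ∀ R₀ : Subalgebra k K, IsNormalLocalModelOf k K (W.comap (algebraMap K L)) R₀ →
              GStableUniformizationAbove (K := K) W R₀) :
    TamePrimeDescent.{u} := by
  intro k K _ _ _ hfg htr L _ _ _ _ hfd hgal hpr hl W hk hrk hres hLU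
  exact h₁ k K hfg htr L hfd hgal hpr hl W hk hrk hres
    (fun R₀ hR₀ => h₂ k K hfg htr L hfd hgal hpr hl W hk hrk hres hLU R₀ hR₀)

end Stable

section Lattice

open Matrix

/-- **The lattice step of Cossart–Piltant 2008, Lemma 9.4, HAL p. 30, l. 23–31**, in `d`
variables, VERBATIM (for `d = 3`): "The lattice `N := {v := (v₁,v₂,v₃) ∈ ℤ³ | v₁t₁ + v₂t₂ + v₃t₃
≡ 0 mod l}` has index `l` in `ℤ³`. By elementary linear algebra, there exists a basis `(v₁,v₂,v₃)`
of `ℤ³` having the following properties (a) `(lv₁,v₂,v₃)` is a basis of `N`, (b)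
`ℕ³ ⊆ ℕv₁ + ℕv₂ + ℕv₃`, and (c) `Σⱼ vᵢⱼ W xⱼ ≥ 0` for `1 ≤ i ≤ 3`." Matrix form (rows of `V` =
the `vᵢ`, `w = (W x₁, …, W x_d)` real — rank one —, `t = (t₁, …, t_d)` the characters mod `l`):
(b) ⇔ the inverse `C` of `V` has entries in `ℕ`; (c) ⇔ `V w ≥ 0`; (a) ⇔ every row except one,
`i₀`, satisfies `Σⱼ vᵢⱼ tⱼ = 0` in `ℤ/l` and row `i₀` does not (given `det V = ±1`, the lattice
spanned by `l v_{i₀}` and the other `vᵢ` has index `l`, and it lies in `N` iff the other rows kill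
`t`; it then equals `N`, of index `l`, iff `t ≠ 0`, iff row `i₀` does not kill `t`). True for
`d = 1` (`latticeABC_dim_one`) and for `d ≥ 3` (reading notes; uses `d ≥ 3`), FALSE for `d = 2`
(module docstring, `fib_pair_mod_five`).
[cite: CossartPiltant2008, Lemma 9.4, proof (HAL p. 30, l. 23–31)] -/
def LatticeABC (d l : ℕ) (t : Fin d → ZMod l) (w : Fin d → ℝ) : Prop :=
  ∃ (V C : Matrix (Fin d) (Fin d) ℤ) (i₀ : Fin d),
    V * C = 1 ∧ (∀ i j, 0 ≤ C i j) ∧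
    (∀ i, 0 ≤ ∑ j, (V i j : ℝ) * w j) ∧
    (∀ i, i ≠ i₀ → ∑ j, ((V i j : ℤ) : ZMod l) * t j = 0) ∧
    ∑ j, ((V i₀ j : ℤ) : ZMod l) * t j ≠ 0

/-- The lattice step in ONE variable: `V = C = (1)`. [folklore] -/
theorem latticeABC_dim_one (l : ℕ) (t : Fin 1 → ZMod l) (w : Fin 1 → ℝ) (hw : 0 ≤ w 0)
    (ht : t 0 ≠ 0) : LatticeABC 1 l t w := by
  refine ⟨1, 1, 0, by simp, ?_, ?_, ?_, ?_⟩
  · intro i j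
    fin_cases i; fin_cases j
    simp
  · intro i
    rw [Subsingleton.elim i 0]
    simp only [Finset.univ_unique, Fin.default_eq_zero, Finset.sum_singleton, Matrix.one_apply_eq,
      Int.cast_one, one_mul]
    exact hw
  · intro i hi
    exact absurd (Subsingleton.elim i 0) hi
  · simpa using ht

/-- Pisano period of `5`: `F(n + 20) ≡ F(n) (mod 5)` (from `Nat.fib_add` with `F₁₉ = 4181 ≡ 1`,
`F₂₀ = 6765 ≡ 0`). [folklore] -/
theorem fib_add_twenty_mod_five (n : ℕ) : Nat.fib (n + 20) % 5 = Nat.fib n % 5 := by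
  have h : Nat.fib (n + 19 + 1) = Nat.fib n * Nat.fib 19 + Nat.fib (n + 1) * Nat.fib (19 + 1) :=
    Nat.fib_add n 19
  have h19 : Nat.fib 19 = 4181 := by decide
  have h20 : Nat.fib (19 + 1) = 6765 := by decide
  rw [h19, h20] at h
  have e : n + 20 = n + 19 + 1 := rfl
  rw [e, h]
  omega

/-- **The two-variable lattice step fails — arithmetic core** (reading note to HAL p. 30,
l. 23–31): `5 ∤ 2F(n+1) − F(n) = L(n)` (Lucas numbers), i.e. `(2F(n+1) + 4F(n)) % 5 ≠ 0` for all
`n`; hence no Fibonacci cone generator `(F(n+1), F(n))` is proportional to `(1,2)` modulo `5`, and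
with `l = 5`, `t = (1,2)`, `w = (φ,1)` the properties (a)(b)(c) have no solution in `ℤ²`.
[folklore] -/
theorem fib_pair_mod_five (n : ℕ) : (2 * Nat.fib (n + 1) + 4 * Nat.fib n) % 5 ≠ 0 := by
  induction n using Nat.strong_induction_on with
  | _ n ih =>
    rcases lt_or_ge n 20 with h | h
    · interval_cases n <;> decide
    · obtain ⟨m, rfl⟩ : ∃ m, n = m + 20 := ⟨n - 20, by omega⟩
      have h1 := fib_add_twenty_mod_five m
      have h2 := fib_add_twenty_mod_five (m + 1)
      rw [Nat.add_right_comm] at h2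
      have h3 := ih m (by omega)
      omega

end Lattice

section Good

open Matrix

variable {d : ℕ}

/-- The elementary matrix of the finishing move of the reading notes (all column operations
`c_k ← c_k + P_i c_i`, `i ≠ k`, at once; on rows: `v_i ← v_i − P_i v_k`): `N i j = P i` if
`j = k` and `i ≠ k`, else `0`; `N² = 0`, so `(1 − N)(1 + N) = 1`. [folklore] -/
def finishN (k : Fin d) (P : Fin d → ℕ) : Matrix (Fin d) (Fin d) ℤ :=
  fun i j => if j = k ∧ i ≠ k then (P i : ℤ) else 0

/-- Off the `k`-th column `N` vanishes. [folklore] -/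
theorem finishN_apply_of_ne {k : Fin d} (P : Fin d → ℕ) {i j : Fin d} (hj : j ≠ k) :
    finishN k P i j = 0 := by
  simp [finishN, hj]

/-- The `k`-th row of `N` vanishes. [folklore] -/
theorem finishN_row_self (k : Fin d) (P : Fin d → ℕ) (j : Fin d) : finishN k P k j = 0 := by
  simp [finishN]

/-- `N ≥ 0` entrywise. [folklore] -/
theorem finishN_nonneg (k : Fin d) (P : Fin d → ℕ) (i j : Fin d) : 0 ≤ finishN k P i j := by
  unfold finishN
  split_ifs
  · exact Int.natCast_nonneg _
  · exact le_rfl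

/-- `N² = 0`. [folklore] -/
theorem finishN_mul_self (k : Fin d) (P : Fin d → ℕ) : finishN k P * finishN k P = 0 := by
  ext i j
  rw [Matrix.mul_apply, Matrix.zero_apply]
  refine Finset.sum_eq_zero fun m _ => ?_
  by_cases hm : m = k
  · rw [hm, finishN_row_self, mul_zero]
  · rw [finishN_apply_of_ne P hm, zero_mul]

/-- `(1 − N)(1 + N) = 1`. [folklore] -/
theorem one_sub_finishN_mul (k : Fin d) (P : Fin d → ℕ) :
    (1 - finishN k P) * (1 + finishN k P) = 1 := by
  rw [sub_mul, one_mul, mul_add, mul_one, finishN_mul_self, add_zero, add_sub_cancel_right]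

/-- Linear functionals commute with the integer matrix product:
`Σⱼ (AB)ᵢⱼ fⱼ = Σₘ Aᵢₘ (Σⱼ Bₘⱼ fⱼ)`. [folklore] -/
theorem castSum_mul_apply {S : Type*} [CommRing S] (A B : Matrix (Fin d) (Fin d) ℤ)
    (f : Fin d → S) (i : Fin d) :
    ∑ j, (((A * B) i j : ℤ) : S) * f j = ∑ m, ((A i m : ℤ) : S) * ∑ j, ((B m j : ℤ) : S) * f j := by
  simp only [Matrix.mul_apply, Int.cast_sum, Int.cast_mul, Finset.sum_mul, Finset.mul_sum,
    mul_assoc]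
  rw [Finset.sum_comm]

/-- The functional of a row of `1 − N`: `Σₘ (1 − N)ᵢₘ gₘ = gᵢ − [i ≠ k] Pᵢ g_k`. [folklore] -/
theorem one_sub_finishN_sum {S : Type*} [CommRing S] (k : Fin d) (P : Fin d → ℕ)
    (g : Fin d → S) (i : Fin d) :
    ∑ m, ((((1 : Matrix (Fin d) (Fin d) ℤ) - finishN k P) i m : ℤ) : S) * g m
      = g i - if i = k then 0 else (P i : S) * g k := by
  simp only [Matrix.sub_apply, Int.cast_sub, sub_mul, Finset.sum_sub_distrib]
  congr 1
  · rw [Finset.sum_eq_single i]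
    · simp
    · intro m _ hm
      simp [Ne.symm hm]
    · intro h
      exact absurd (Finset.mem_univ i) h
  · by_cases hi : i = k
    · subst hi
      simp [finishN_row_self]
    · rw [if_neg hi, Finset.sum_eq_single k]
      · simp [finishN, hi]
      · intro m _ hm
        simp [finishN_apply_of_ne P hm]
      · intro h
        exact absurd (Finset.mem_univ k) h

/-- The functional of a row of `(1 − N)V`. [folklore] -/
theorem good_row_sum {S : Type*} [CommRing S] (k : Fin d) (P : Fin d → ℕ)
    (V : Matrix (Fin d) (Fin d) ℤ) (f : Fin d → S) (i : Fin d) :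
    ∑ j, (((((1 : Matrix (Fin d) (Fin d) ℤ) - finishN k P) * V) i j : ℤ) : S) * f j
      = (∑ j, ((V i j : ℤ) : S) * f j) -
        if i = k then 0 else (P i : S) * ∑ j, ((V k j : ℤ) : S) * f j := by
  rw [castSum_mul_apply]
  exact one_sub_finishN_sum k P _ i

/-- **The finishing criterion ("GOOD") of the reading notes to HAL p. 30, l. 23–31** (any number
of variables `d`): if `(V, C)` is a unimodular pair with `C ≥ 0` and `V w ≥ 0` (an admissible
cone containing `w`), and some row `k` has character `τ_k := Σⱼ v_kⱼ tⱼ ≠ 0` while every other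
row `i` has `τᵢ = Pᵢ τ_k` with `Pᵢ ∈ ℕ` and `Pᵢ · (v_k · w) ≤ vᵢ · w`, then the row operations
`vᵢ ← vᵢ − Pᵢ v_k` (`i ≠ k`) produce a basis with properties (a)(b)(c), i.e. `LatticeABC` holds.
This is the last step of the proof of the lattice statement for `d ≥ 3`; the work in that proof
is to REACH such a state by legal moves. [folklore] -/
theorem latticeABC_of_good {l : ℕ} (t : Fin d → ZMod l) (w : Fin d → ℝ)
    (V C : Matrix (Fin d) (Fin d) ℤ) (hVC : V * C = 1) (hC : ∀ i j, 0 ≤ C i j)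
    (ha : ∀ i, 0 ≤ ∑ j, (V i j : ℝ) * w j) (k : Fin d) (P : Fin d → ℕ)
    (hτ : ∑ j, ((V k j : ℤ) : ZMod l) * t j ≠ 0)
    (hP : ∀ i, i ≠ k →
      ∑ j, ((V i j : ℤ) : ZMod l) * t j = (P i : ZMod l) * ∑ j, ((V k j : ℤ) : ZMod l) * t j)
    (hdom : ∀ i, i ≠ k → (P i : ℝ) * ∑ j, (V k j : ℝ) * w j ≤ ∑ j, (V i j : ℝ) * w j) :
    LatticeABC d l t w := by
  refine ⟨(1 - finishN k P) * V, C * (1 + finishN k P), k, ?_, ?_, ?_, ?_, ?_⟩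
  · rw [Matrix.mul_assoc, ← Matrix.mul_assoc V, hVC, Matrix.one_mul, one_sub_finishN_mul]
  · intro i j
    rw [Matrix.mul_apply]
    refine Finset.sum_nonneg fun m _ => mul_nonneg (hC i m) ?_
    rw [Matrix.add_apply, Matrix.one_apply]
    refine add_nonneg ?_ (finishN_nonneg k P m j)
    split_ifs
    · exact zero_le_one
    · exact le_rfl
  · intro i
    rw [good_row_sum]
    by_cases hi : i = k
    · rw [if_pos hi, sub_zero]
      exact ha i
    · rw [if_neg hi, sub_nonneg]
      exact hdom i hi
  · intro i hi
    rw [good_row_sum, if_neg hi, hP i hi, sub_self]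
  · rw [good_row_sum, if_pos rfl, sub_zero]
    exact hτ

end Good

section TwoVariables

open Real
open scoped goldenRatio

/-- Character states `(τ₁, τ₂) ∈ (ℤ/5)²` met along the Euclid (Stern–Brocot) chain of the weight
`w = (φ, 1)` for `t = (1, 2)`, `l = 5`, at the stages where the FIRST cone coordinate is the
larger one (`a₁ = φ a₂`). [folklore] -/
def chainState₁ (τ₁ τ₂ : ZMod 5) : Bool :=
  (τ₁ = 1 ∧ τ₂ = 2) || (τ₁ = 4 ∧ τ₂ = 3) || (τ₁ = 2 ∧ τ₂ = 4) || (τ₁ = 3 ∧ τ₂ = 1)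

/-- Same, at the stages where the SECOND cone coordinate is the larger one (`a₂ = φ a₁`).
[folklore] -/
def chainState₂ (τ₁ τ₂ : ZMod 5) : Bool :=
  (τ₁ = 4 ∧ τ₂ = 2) || (τ₁ = 1 ∧ τ₂ = 3) || (τ₁ = 2 ∧ τ₂ = 1) || (τ₁ = 3 ∧ τ₂ = 4)

/-- The forced move from a first-coordinate-larger stage (`v₁ ← v₁ − v₂`). [folklore] -/
theorem chainState₁_step :
    ∀ τ₁ τ₂ : ZMod 5, chainState₁ τ₁ τ₂ = true → chainState₂ (τ₁ - τ₂) τ₂ = true := by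
  decide

/-- The forced move from a second-coordinate-larger stage (`v₂ ← v₂ − v₁`). [folklore] -/
theorem chainState₂_step :
    ∀ τ₁ τ₂ : ZMod 5, chainState₂ τ₁ τ₂ = true → chainState₁ τ₁ (τ₂ - τ₁) = true := by
  decide

/-- No chain state has a vanishing character (Lucas numbers are prime to `5`). [folklore] -/
theorem chainState_ne_zero : ∀ τ₁ τ₂ : ZMod 5,
    (chainState₁ τ₁ τ₂ = true ∨ chainState₂ τ₁ τ₂ = true) → τ₁ ≠ 0 ∧ τ₂ ≠ 0 := by
  decide

/-- **Column domination** for nonnegative unimodular `2 × 2` integer matrices `(p q; r s)`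
(the `SL₂(ℕ)` / Stern–Brocot structure): the matrix is the identity, the transposition, or one
column dominates the other entrywise, the dominated one being nonzero. [folklore] -/
theorem column_domination (p q r s : ℤ) (hp : 0 ≤ p) (hq : 0 ≤ q) (hr : 0 ≤ r) (hs : 0 ≤ s)
    (hd : p * s - q * r = 1 ∨ p * s - q * r = -1) :
    (p = 1 ∧ q = 0 ∧ r = 0 ∧ s = 1) ∨ (p = 0 ∧ q = 1 ∧ r = 1 ∧ s = 0) ∨
    (q ≤ p ∧ s ≤ r ∧ 0 < q + s) ∨ (p ≤ q ∧ r ≤ s ∧ 0 < p + r) := by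
  rcases le_or_gt q p with hqp | hpq <;> rcases le_or_gt s r with hsr | hrs
  · -- `q ≤ p`, `s ≤ r`
    refine Or.inr (Or.inr (Or.inl ⟨hqp, hsr, ?_⟩))
    by_contra h
    obtain ⟨rfl, rfl⟩ : q = 0 ∧ s = 0 := ⟨by omega, by omega⟩
    simp at hd
  · -- `q ≤ p`, `r < s`
    rcases hqp.lt_or_eq with hlt | heq
    · -- `q < p`, `r < s`: only the identity
      have h1 : q * r ≤ (p - 1) * (s - 1) := mul_le_mul (by omega) (by omega) hr (by omega)
      have h2 : (p - 1) * (s - 1) = p * s - p - s + 1 := by ring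
      rw [h2] at h1
      rcases hd with hd | hd
      · have hps : p + s ≤ 2 := by linarith
        obtain ⟨rfl, rfl⟩ : p = 1 ∧ s = 1 := ⟨by omega, by omega⟩
        have hqr : q * r = 0 := by linarith
        rcases mul_eq_zero.mp hqr with h | h
        · exact Or.inl ⟨rfl, h, by omega, rfl⟩
        · exact Or.inl ⟨rfl, by omega, h, rfl⟩
      · exfalso
        have : p + s ≤ 0 := by linarith
        omega
    · -- `q = p`: then `p (s - r) = ±1`, so `p ≠ 0`
      refine Or.inr (Or.inr (Or.inr ⟨heq.ge, hrs.le, ?_⟩))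
      by_contra h
      have hp0 : p = 0 := by omega
      have hr0 : r = 0 := by omega
      rw [hp0, hr0] at hd
      simp at hd
  · -- `p < q`, `s ≤ r`
    rcases hsr.lt_or_eq with hlt | heq
    · -- `p < q`, `s < r`: only the transposition
      have h1 : p * s ≤ (q - 1) * (r - 1) := mul_le_mul (by omega) (by omega) hs (by omega)
      have h2 : (q - 1) * (r - 1) = q * r - q - r + 1 := by ring
      rw [h2] at h1
      rcases hd with hd | hd
      · exfalso
        have : q + r ≤ 0 := by linarith
        omega
      · have hqr : q + r ≤ 2 := by linarith
        obtain ⟨rfl, rfl⟩ : q = 1 ∧ r = 1 := ⟨by omega, by omega⟩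
        have hps : p * s = 0 := by linarith
        rcases mul_eq_zero.mp hps with h | h
        · exact Or.inr (Or.inl ⟨h, rfl, rfl, by omega⟩)
        · exact Or.inr (Or.inl ⟨by omega, rfl, rfl, h⟩)
    · -- `s = r`: then `(p - q) r = ±1`, so `r ≠ 0`
      refine Or.inr (Or.inr (Or.inr ⟨hpq.le, heq.ge, ?_⟩))
      by_contra h
      have hp0 : p = 0 := by omega
      have hr0 : r = 0 := by omega
      rw [hp0, hr0] at hd
      simp at hd
  · -- `p < q`, `r < s`
    exact Or.inr (Or.inr (Or.inr ⟨hpq.le, hrs.le, by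
      by_contra h
      obtain ⟨rfl, rfl⟩ : p = 0 ∧ r = 0 := ⟨by omega, by omega⟩
      simp at hd⟩))

/-- **The Euclid-chain invariant** (reading notes to HAL p. 30, l. 23–31, two variables). Let
`C = (p q; r s) ≥ 0` and `V = (α β; γ δ)` be integer matrices with `V C = 1`, and suppose the
weight `w = (φ, 1)` lies in the cone of `C`, i.e. `a := V w ≥ 0`. Then `(V, a)` is a stage of the
Euclid chain of `(φ, 1)`: either `a₁ = φ a₂ > 0` and the characters `(α + 2β, γ + 2δ) mod 5` form a
`chainState₁`, or `a₂ = φ a₁ > 0` and they form a `chainState₂`. Proof: induction on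
`p + q + r + s` by column domination; the cone condition forces each move. [folklore] -/
theorem euclidChain_invariant (n : ℕ) :
    ∀ (p q r s α β γ δ : ℤ) (a₁ a₂ : ℝ),
      0 ≤ p → 0 ≤ q → 0 ≤ r → 0 ≤ s → p + q + r + s ≤ n →
      α * p + β * r = 1 → α * q + β * s = 0 → γ * p + δ * r = 0 → γ * q + δ * s = 1 →
      a₁ = α * φ + β → a₂ = γ * φ + δ → 0 ≤ a₁ → 0 ≤ a₂ →
      (a₁ = φ * a₂ ∧ 0 < a₂ ∧ chainState₁ ((α : ZMod 5) + 2 * β) ((γ : ZMod 5) + 2 * δ) = true) ∨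
      (a₂ = φ * a₁ ∧ 0 < a₁ ∧ chainState₂ ((α : ZMod 5) + 2 * β) ((γ : ZMod 5) + 2 * δ) = true) := by
  induction n using Nat.strong_induction_on with
  | _ n ih =>
  intro p q r s α β γ δ a₁ a₂ hp hq hr hs hn e1 e2 e3 e4 ha₁ ha₂ h₁ h₂
  have hφ := one_lt_goldenRatio
  have hsq := goldenRatio_sq
  have hdet : (p * s - q * r) * (α * δ - β * γ) = 1 := by
    calc (p * s - q * r) * (α * δ - β * γ)
        = (α * p + β * r) * (γ * q + δ * s) - (α * q + β * s) * (γ * p + δ * r) := by ring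
      _ = 1 := by rw [e1, e2, e3, e4]; ring
  have hd := Int.eq_one_or_neg_one_of_mul_eq_one hdet
  rcases column_domination p q r s hp hq hr hs hd with
      ⟨rfl, rfl, rfl, rfl⟩ | ⟨rfl, rfl, rfl, rfl⟩ | ⟨hqp, hsr, hpos⟩ | ⟨hpq, hrs, hpos⟩
  · -- `C = 1`: `V = 1`, `a = (φ, 1)`
    simp only [mul_one, mul_zero, add_zero, zero_add] at e1 e2 e3 e4
    subst e1 e2 e3 e4
    simp only [Int.cast_one, one_mul, Int.cast_zero, add_zero, zero_mul, zero_add] at ha₁ ha₂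
    refine Or.inl ⟨by rw [ha₁, ha₂, mul_one], by rw [ha₂]; exact one_pos, ?_⟩
    simp only [Int.cast_one, Int.cast_zero, mul_zero, add_zero, mul_one, zero_add]
    decide
  · -- `C` = the transposition: `V = C`, `a = (1, φ)`
    simp only [mul_one, mul_zero, add_zero, zero_add] at e1 e2 e3 e4
    subst e1 e2 e3 e4
    simp only [Int.cast_one, one_mul, Int.cast_zero, add_zero, zero_mul, zero_add] at ha₁ ha₂
    refine Or.inr ⟨by rw [ha₁, ha₂, mul_one], by rw [ha₁]; exact one_pos, ?_⟩
    simp only [Int.cast_one, Int.cast_zero, mul_zero, add_zero, mul_one, zero_add]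
    decide
  · -- second column dominated by the first: `C = C' L`, `C' = (c₁ − c₂, c₂)`, `V' = L V`,
    -- `a' = (a₁, a₁ + a₂)`
    have ih' := ih (n - 1) (by omega) (p - q) q (r - s) s α β (α + γ) (β + δ) a₁ (a₁ + a₂)
      (by omega) hq (by omega) hs (by omega)
      (by linear_combination e1 - e2) e2 (by linear_combination e1 - e2 + e3 - e4)
      (by linear_combination e2 + e4) ha₁ (by rw [ha₁, ha₂]; push_cast; ring) h₁ (add_nonneg h₁ h₂)
    rcases ih' with ⟨hrel, hpos', hst⟩ | ⟨hrel, hpos', hst⟩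
    · -- `a₁ = φ (a₁ + a₂)` with `a₁ + a₂ > 0` is impossible
      exfalso
      nlinarith [mul_pos (sub_pos.mpr hφ) hpos']
    · refine Or.inl ⟨?_, ?_, ?_⟩
      · linear_combination (-φ) * hrel - a₁ * hsq
      · nlinarith [mul_pos (sub_pos.mpr hφ) hpos']
      · have e : ((α + γ : ℤ) : ZMod 5) + 2 * ((β + δ : ℤ) : ZMod 5) - ((α : ZMod 5) + 2 * β)
            = (γ : ZMod 5) + 2 * δ := by
          push_cast; ring
        have := chainState₂_step _ _ hst
        rwa [e] at this
  · -- first column dominated by the second: `C = C' R`, `C' = (c₁, c₂ − c₁)`, `V' = R V`,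
    -- `a' = (a₁ + a₂, a₂)`
    have ih' := ih (n - 1) (by omega) p (q - p) r (s - r) (α + γ) (β + δ) γ δ (a₁ + a₂) a₂
      hp (by omega) hr (by omega) (by omega)
      (by linear_combination e1 + e3) (by linear_combination e2 - e1 + e4 - e3) e3
      (by linear_combination e4 - e3) (by rw [ha₁, ha₂]; push_cast; ring) ha₂ (add_nonneg h₁ h₂) h₂
    rcases ih' with ⟨hrel, hpos', hst⟩ | ⟨hrel, hpos', hst⟩
    · refine Or.inr ⟨?_, ?_, ?_⟩
      · linear_combination (-φ) * hrel - a₂ * hsq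
      · nlinarith [mul_pos (sub_pos.mpr hφ) hpos']
      · have e : ((α + γ : ℤ) : ZMod 5) + 2 * ((β + δ : ℤ) : ZMod 5) - ((γ : ZMod 5) + 2 * δ)
            = (α : ZMod 5) + 2 * β := by
          push_cast; ring
        have := chainState₁_step _ _ hst
        rwa [e] at this
    · -- `a₂ = φ (a₁ + a₂)` with `a₁ + a₂ > 0` is impossible
      exfalso
      nlinarith [mul_pos (sub_pos.mpr hφ) hpos']

/-- **The two-variable lattice step is FALSE** (reading notes, GAPS.md G7-A21.L): with `l = 5`,
characters `t = (1, 2)` and weights `w = (φ, 1)` (`φ` the golden ratio: `W x₁, W x₂` rationally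
independent), NO basis of `ℤ²` has the properties (a)(b)(c) of HAL p. 30, l. 23–31. The
admissible unimodular nonnegative `C` are exactly the Fibonacci (Euclid-chain) matrices, and by
`euclidChain_invariant` both rows of `V = C⁻¹` have non-vanishing character. Hence the printed
"elementary linear algebra" must use `d ≥ 3`. [folklore] -/
theorem not_latticeABC_two_five : ¬ LatticeABC 2 5 ![1, 2] ![φ, 1] := by
  rintro ⟨V, C, i₀, hVC, hC, ha, hτ, hτ₀⟩
  have e1 : V 0 0 * C 0 0 + V 0 1 * C 1 0 = 1 := by
    have h := congrFun (congrFun hVC 0) 0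
    rwa [Matrix.mul_apply, Fin.sum_univ_two, Matrix.one_apply_eq] at h
  have e2 : V 0 0 * C 0 1 + V 0 1 * C 1 1 = 0 := by
    have h := congrFun (congrFun hVC 0) 1
    rwa [Matrix.mul_apply, Fin.sum_univ_two, Matrix.one_apply_ne (show (0 : Fin 2) ≠ 1 by decide)]
      at h
  have e3 : V 1 0 * C 0 0 + V 1 1 * C 1 0 = 0 := by
    have h := congrFun (congrFun hVC 1) 0
    rwa [Matrix.mul_apply, Fin.sum_univ_two, Matrix.one_apply_ne (show (1 : Fin 2) ≠ 0 by decide)]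
      at h
  have e4 : V 1 0 * C 0 1 + V 1 1 * C 1 1 = 1 := by
    have h := congrFun (congrFun hVC 1) 1
    rwa [Matrix.mul_apply, Fin.sum_univ_two, Matrix.one_apply_eq] at h
  have hw : ∀ i, ∑ j, (V i j : ℝ) * ![φ, 1] j = (V i 0 : ℝ) * φ + (V i 1 : ℝ) := by
    intro i
    simp only [Fin.sum_univ_two, Fin.isValue, Matrix.cons_val_zero, Matrix.cons_val_one, mul_one]
  have hc : ∀ i, ∑ j, ((V i j : ℤ) : ZMod 5) * ![(1 : ZMod 5), 2] j
      = ((V i 0 : ℤ) : ZMod 5) + 2 * ((V i 1 : ℤ) : ZMod 5) := by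
    intro i
    simp only [Fin.sum_univ_two, Fin.isValue, Matrix.cons_val_zero, Matrix.cons_val_one, mul_one]
    ring
  have ha₀ := ha 0
  have ha₁ := ha 1
  rw [hw] at ha₀ ha₁
  have key := euclidChain_invariant _ (C 0 0) (C 0 1) (C 1 0) (C 1 1) (V 0 0) (V 0 1) (V 1 0)
    (V 1 1) _ _ (hC 0 0) (hC 0 1) (hC 1 0) (hC 1 1) (Int.self_le_toNat _) e1 e2 e3 e4 rfl rfl
    ha₀ ha₁
  have hne := chainState_ne_zero _ _ (key.imp (fun h => h.2.2) (fun h => h.2.2))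
  fin_cases i₀
  · have h := hτ 1 (by decide)
    rw [hc] at h
    exact hne.2 h
  · have h := hτ 0 (by decide)
    rw [hc] at h
    exact hne.1 h

end TwoVariables

section ThreeVariables

open Real
open scoped goldenRatio

/-- **… and TRUE again with a third coordinate** (kernel illustration of GAPS.md F2-(ii), "the
third coordinate is a reservoir of value"): the golden-ratio data of `not_latticeABC_two_five`
extended by one coordinate, `w = (φ, 1, 1)`, `t = (1, 2, 2)`, `l = 5`, DO admit a basis with
(a)(b)(c). Witness found by the legal moves `c₂ += c₁; c₁ += c₂; c₂ += c₁; c₁ += 4c₃` followed by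
the finishing move of `latticeABC_of_good` (`k = 3`, `P = (2, 1)`):
`V = (18 −27 −2; 7 −10 −1; −8 12 1)`, `C = V⁻¹ = (2 3 7; 1 2 4; 4 0 9) ≥ 0`,
`Vw = (18φ − 29, 7φ − 11, 13 − 8φ) ≥ 0`, characters `Vt ≡ (0, 0, 3) (mod 5)`. [folklore] -/
theorem latticeABC_three_five_golden : LatticeABC 3 5 ![1, 2, 2] ![φ, 1, 1] := by
  have h5l : (20 : ℝ) / 9 < √5 := by
    rw [Real.lt_sqrt (by norm_num)]
    norm_num
  have h5u : √5 < 9 / 4 := by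
    rw [Real.sqrt_lt' (by norm_num)]
    norm_num
  refine ⟨!![18, -27, -2; 7, -10, -1; -8, 12, 1], !![2, 3, 7; 1, 2, 4; 4, 0, 9], 2,
    ?_, ?_, ?_, ?_, ?_⟩
  · decide
  · decide
  · intro i
    fin_cases i <;> simp [Fin.sum_univ_three, Real.goldenRatio] <;> linarith [h5l, h5u]
  · intro i hi
    fin_cases i
    · simp [Fin.sum_univ_three]
      decide
    · simp [Fin.sum_univ_three]
      decide
    · exact absurd rfl hi
  · simp [Fin.sum_univ_three]
    decide

end ThreeVariables

end Literature.AlgebraicGeometry.CossartPiltant200819.CP2008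

end
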